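import Literature.AlgebraicGeometry.Resolution.WeightedCentreLayerEquation
import Literature.AlgebraicGeometry.Resolution.WeightedCentreBlockShift
import Literature.AlgebraicGeometry.Resolution.WeightedCentreDirectionalDerivative
import HarnessLib

/-!
# The one-round exit below the moving variables: a block that carries a shift has `V ≠ 0`

Uniform value line: typed theorems in the polynomial weighted-centre model `W(f)` — NOT a
resolution theorem, NOT summit progress; AI review is weaker than expert review.

This file joins the layer equation (⋆) (`WeightedCentreLayerEquation`) with the kernel extraction
(`WeightedCentreBlockShift`).  Consider a block substitution `ψ` (block `B`, shifts `S_k`)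
that FIXES every variable outside the block (the lowest block carrying a maximal-rate term:
nothing below it moves, `ψ♭ = id`), and a polynomial `H` of block degree `≤ m + 1`, `m ≠ 0`,
satisfying the face equation `ψ H = H - c`.  Then
* `IsBlockSubstitution.sum_mul_pderiv_top_eq_zero` — (⋆) collapses to `Σ_{k ∈ B} S_k ∂ₖ F = 0`
  for the top block layer `F = [H]ₘ₊₁` (derived here);
* `IsBlockSubstitution.shift_eq_zero_of_injective` — if moreover `F` involves no lower variable,
  the shifts only lower variables, and `v ↦ Σ_k v_k ∂ₖ F` is injective on constant vectors
  (`V = 0`), then every shift vanishes (derived here);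
* `IsBlockSubstitution.exists_kernel_vector` — contrapositive: a block that does carry a shift
  has a nonzero constant vector `v` with `Σ_k v_k ∂ₖ F = 0`, i.e. `V ≠ 0` (derived here);
* `notMem_vars_lineSubst_of_kernel` — the exit: in characteristic `p`, a kernel vector `v` with
  `v_{k₀} ≠ 0` and a top layer homogeneous of degree `< p` give, after the linear block change
  `lineSubst k₀ v` (`WeightedCentreDirectionalDerivative`), a polynomial NOT involving `X_{k₀}`
  (derivative criterion `notMem_vars_of_pderiv_eq_zero_of_totalDegree_lt`) (derived here);
* `IsBlockSubstitution.exists_lineSubst_notMem_vars` — everything together: a block below which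
  nothing moves and which carries a shift has a graded automorphism of the block after which
  the top layer misses a block coordinate (derived here) — the input of the upper-pin lemma F1;
* `IsBlockSubstitution.block_basis_identity` / `…exists_straightening_of_face_equation` — the
  `V = 0` branch: (⋆) written in the block monomial basis and, with `M(0)` injective, the
  straightened block coordinates `X_k - g_k` fixed by `ψ` (`WeightedCentreBlockShift`) (derived here);
* `exists_block_expansion` / `IsBlockSubstitution.exists_straightening_of_injective` — the same
  with the expansion data constructed, so that the only inputs are the block substitution, the
  face equation, a pure-block top layer and `M(0)` injective (derived here).

[cite: HauserWagner2014, (T) translational move F*(y,z) = F(yz+tz,z) (arXiv p. 14–15)]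
[cite: Hironaka1970AdditiveGroups, additive forms and differential operators]
-/

open MvPolynomial Finsupp

namespace Literature.AlgebraicGeometry.Resolution.WeightedBlowup

variable {K : Type*} [Field K] {σ : Type*} [DecidableEq σ]

/-- If `ψ` fixes every variable outside the block, the block flattening `ψ♭` is the identity
(derived here). [cite: HauserWagner2014, (T) translational move (arXiv p. 14)] -/
theorem blockFlat_eq_self_of_fix {B : Finset σ} {ψ : MvPolynomial σ K →ₐ[K] MvPolynomial σ K}
    (hfix : ∀ i ∉ B, ψ (X i) = X i) (P : MvPolynomial σ K) : blockFlat B ψ P = P := by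
  unfold blockFlat
  have hfun : (fun i => if i ∈ B then X i else ψ (X i)) = (X : σ → MvPolynomial σ K) := by
    funext i
    split_ifs with h
    · rfl
    · exact hfix i h
  rw [hfun, aeval_X_left, AlgHom.id_apply]

/-- With `ψ♭ = id` the block differential is the plain first-order operator `Σ_{k ∈ B} S_k ∂ₖ`
(derived here). [cite: Hironaka1970AdditiveGroups, differential operators on forms] -/
theorem blockDifferential_eq_sum_of_fix {B : Finset σ}
    {ψ : MvPolynomial σ K →ₐ[K] MvPolynomial σ K} (hfix : ∀ i ∉ B, ψ (X i) = X i)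
    (S : σ → MvPolynomial σ K) (P : MvPolynomial σ K) :
    blockDifferential B ψ S P = ∑ k ∈ B, S k * pderiv k P := by
  unfold blockDifferential
  exact Finset.sum_congr rfl fun k _ => by rw [blockFlat_eq_self_of_fix hfix]

/-- **(⋆) below the moving variables.**  For a block substitution fixing every variable outside
the block, the face equation `ψ H = H - c` (block degree of `H` at most `m + 1`, `m ≠ 0`) gives
`Σ_{k ∈ B} S_k · ∂ₖ [H]ₘ₊₁ = 0` (derived here: the layer equation with `ψ♭ = id`).
[cite: HauserWagner2014, (T) translational move (arXiv p. 14–15)] -/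
theorem IsBlockSubstitution.sum_mul_pderiv_top_eq_zero {B : Finset σ}
    {ψ : MvPolynomial σ K →ₐ[K] MvPolynomial σ K} {S : σ → MvPolynomial σ K}
    (hψ : IsBlockSubstitution B ψ S) (hfix : ∀ i ∉ B, ψ (X i) = X i)
    {H : MvPolynomial σ K} {m : ℕ} (hH : ∀ d ∈ H.support, weight (blockWeight B) d ≤ m + 1)
    (hm : m ≠ 0) {c : K} (hQ : ψ H = H - C c) :
    ∑ k ∈ B, S k * pderiv k (weightedHomogeneousComponent (blockWeight B) (m + 1) H) = 0 := by
  have h := hψ.layer_equation hH hm hQ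
  rwa [blockDifferential_eq_sum_of_fix hfix, blockFlat_eq_self_of_fix hfix, sub_self] at h

/-- **`V = 0` forces `S_B = 0`.**  In the situation of `sum_mul_pderiv_top_eq_zero`, if the top
block layer `F = [H]ₘ₊₁` involves no variable of `T`, the shifts involve only variables of `T`,
and `v ↦ Σ_{k ∈ B} v_k ∂ₖ F` is injective on constant vectors, then `S_k = 0` for every
`k ∈ B` (derived here). [cite: Hironaka1970AdditiveGroups, additive forms and differential operators] -/
theorem IsBlockSubstitution.shift_eq_zero_of_injective {B : Finset σ}
    {ψ : MvPolynomial σ K →ₐ[K] MvPolynomial σ K} {S : σ → MvPolynomial σ K}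
    (hψ : IsBlockSubstitution B ψ S) (hfix : ∀ i ∉ B, ψ (X i) = X i)
    {H : MvPolynomial σ K} {m : ℕ} (hH : ∀ d ∈ H.support, weight (blockWeight B) d ≤ m + 1)
    (hm : m ≠ 0) {c : K} (hQ : ψ H = H - C c) (T : Set σ)
    (hF : ∀ d ∈ (weightedHomogeneousComponent (blockWeight B) (m + 1) H).support,
      ∀ i ∈ d.support, i ∉ T)
    (hS : ∀ k ∈ B, ∀ d ∈ (S k).support, ∀ i ∈ d.support, i ∈ T)
    (hinj : ∀ v : σ → K,
      (∑ k ∈ B, v k • pderiv k (weightedHomogeneousComponent (blockWeight B) (m + 1) H)) = 0 →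
        ∀ k ∈ B, v k = 0) :
    ∀ k ∈ B, S k = 0 :=
  eq_zero_of_sum_mul_pderiv_eq_zero B T hF hS hinj (hψ.sum_mul_pderiv_top_eq_zero hfix hH hm hQ)

/-- **One-round exit (non-boundary case).**  A block substitution fixing everything outside the
block, satisfying the face equation, and carrying a NONZERO shift on the block (in the lower
variables `T`, the top block layer being free of them) has a nonzero constant kernel vector:
`∃ v ≠ 0, Σ_{k ∈ B} v_k ∂ₖ [H]ₘ₊₁ = 0`, i.e. `V ≠ 0` (derived here).
[cite: HauserWagner2014, (T) translational move (arXiv p. 14–15)]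
[cite: Hironaka1970AdditiveGroups, additive forms and differential operators] -/
theorem IsBlockSubstitution.exists_kernel_vector {B : Finset σ}
    {ψ : MvPolynomial σ K →ₐ[K] MvPolynomial σ K} {S : σ → MvPolynomial σ K}
    (hψ : IsBlockSubstitution B ψ S) (hfix : ∀ i ∉ B, ψ (X i) = X i)
    {H : MvPolynomial σ K} {m : ℕ} (hH : ∀ d ∈ H.support, weight (blockWeight B) d ≤ m + 1)
    (hm : m ≠ 0) {c : K} (hQ : ψ H = H - C c) (T : Set σ)
    (hF : ∀ d ∈ (weightedHomogeneousComponent (blockWeight B) (m + 1) H).support,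
      ∀ i ∈ d.support, i ∉ T)
    (hS : ∀ k ∈ B, ∀ d ∈ (S k).support, ∀ i ∈ d.support, i ∈ T)
    {k₀ : σ} (hk₀ : k₀ ∈ B) (hne : S k₀ ≠ 0) :
    ∃ v : σ → K,
      (∑ k ∈ B, v k • pderiv k (weightedHomogeneousComponent (blockWeight B) (m + 1) H)) = 0 ∧
        ∃ k ∈ B, v k ≠ 0 :=
  exists_kernel_vector_of_shift_ne_zero B T hF hS (hψ.sum_mul_pderiv_top_eq_zero hfix hH hm hQ)
    hk₀ hne

/-! ## The exit through the derivative criterion -/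

omit [DecidableEq σ] in
/-- **Exit.**  In characteristic `p`: if `v` vanishes off `B`, `Σ_{k ∈ B} v_k ∂ₖ F = 0`, and `F` is
homogeneous of degree `n < p`, then after the linear block change `lineSubst k₀ v` the polynomial
`F ∘ A` does not involve `X_{k₀}` (derived here: chain rule + derivative criterion + degree bound).
[cite: Hironaka1970AdditiveGroups, additive forms and differential operators] -/
theorem notMem_vars_lineSubst_of_kernel [DecidableEq σ] (p : ℕ) [CharP K p] {B : Finset σ}
    {v : σ → K} (hv : ∀ k ∉ B, v k = 0) (k₀ : σ) {F : MvPolynomial σ K} {n : ℕ}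
    (hF : F.IsHomogeneous n) (hn : n < p) (hker : (∑ k ∈ B, v k • pderiv k F) = 0) :
    k₀ ∉ (lineSubst k₀ v F).vars := by
  refine notMem_vars_of_pderiv_eq_zero_of_totalDegree_lt p
    (pderiv_lineSubst_eq_zero k₀ B hv hker) (lt_of_le_of_lt ?_ hn)
  have hhom : (lineSubst k₀ v F).IsHomogeneous n :=
    isWeightedHomogeneous_lineSubst k₀ (1 : σ → ℕ) (fun _ _ => rfl) hF
  exact hhom.totalDegree_le

/-- **The block step below the moving variables, assembled.**  Characteristic `p`; a block
substitution fixing every variable outside `B`, with shifts in the lower variables `T`, satisfying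
the face equation for `H` (block degree `≤ m + 1`, `m ≠ 0`), whose top block layer `F = [H]ₘ₊₁` is
free of `T` and homogeneous of degree `n < p`; if the block carries a shift (`S_{k₁} ≠ 0`), then
there are `k₀ ∈ B` and a direction `v` supported on `B` with `v_{k₀} ≠ 0` — so `lineSubst k₀ v` is a
bijective substitution, graded for the block weight — after which `F` misses the coordinate
`X_{k₀}` (derived here; the exit handed to the upper-pin lemma F1).
[cite: HauserWagner2014, (T) translational move (arXiv p. 14–15)]
[cite: Hironaka1970AdditiveGroups, additive forms and differential operators] -/
theorem IsBlockSubstitution.exists_lineSubst_notMem_vars (p : ℕ) [CharP K p] {B : Finset σ}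
    {ψ : MvPolynomial σ K →ₐ[K] MvPolynomial σ K} {S : σ → MvPolynomial σ K}
    (hψ : IsBlockSubstitution B ψ S) (hfix : ∀ i ∉ B, ψ (X i) = X i)
    {H : MvPolynomial σ K} {m : ℕ} (hH : ∀ d ∈ H.support, weight (blockWeight B) d ≤ m + 1)
    (hm : m ≠ 0) {c : K} (hQ : ψ H = H - C c) (T : Set σ)
    (hF : ∀ d ∈ (weightedHomogeneousComponent (blockWeight B) (m + 1) H).support,
      ∀ i ∈ d.support, i ∉ T)
    (hS : ∀ k ∈ B, ∀ d ∈ (S k).support, ∀ i ∈ d.support, i ∈ T)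
    {n : ℕ} (hhom : (weightedHomogeneousComponent (blockWeight B) (m + 1) H).IsHomogeneous n)
    (hn : n < p) {k₁ : σ} (hk₁ : k₁ ∈ B) (hne : S k₁ ≠ 0) :
    ∃ k₀ ∈ B, ∃ v : σ → K, v k₀ ≠ 0 ∧ (∀ k ∉ B, v k = 0) ∧
      Function.Bijective (lineSubst k₀ v) ∧
      (∀ {P : MvPolynomial σ K} {j : ℕ}, IsWeightedHomogeneous (blockWeight B) P j →
        IsWeightedHomogeneous (blockWeight B) (lineSubst k₀ v P) j) ∧
      k₀ ∉ (lineSubst k₀ v (weightedHomogeneousComponent (blockWeight B) (m + 1) H)).vars := by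
  obtain ⟨v, hv, k₀, hk₀, hvk₀⟩ := hψ.exists_kernel_vector hfix hH hm hQ T hF hS hk₁ hne
  -- cut the kernel vector down to the block (the sum only sees `B`)
  set v' : σ → K := fun j => if j ∈ B then v j else 0 with hv'
  have hv'B : ∀ k ∉ B, v' k = 0 := fun k hk => by simp [hv', hk]
  have hv'k₀ : v' k₀ ≠ 0 := by simpa [hv', hk₀] using hvk₀
  have hker : (∑ k ∈ B, v' k • pderiv k (weightedHomogeneousComponent (blockWeight B) (m + 1) H))
      = 0 := by
    rw [← hv]
    exact Finset.sum_congr rfl fun k hk => by simp [hv', hk]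
  refine ⟨k₀, hk₀, v', hv'k₀, hv'B, lineSubst_bijective k₀ hv'k₀, fun hP => ?_, ?_⟩
  · refine isWeightedHomogeneous_lineSubst k₀ (blockWeight B) (fun j hj => ?_) hP
    have hjB : j ∈ B := by
      by_contra h
      exact hj (hv'B j h)
    rw [blockWeight_of_mem hjB, blockWeight_of_mem hk₀]
  · exact notMem_vars_lineSubst_of_kernel p hv'B k₀ hhom hn hker

/-! ## The `V = 0` branch from the face equation: straightening -/

/-- Two `K`-algebra endomorphisms of `K[X]` that agree on the variables occurring in `P` agree on
`P`. [folklore] -/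
private theorem algHom_congr_vars {φ₁ φ₂ : MvPolynomial σ K →ₐ[K] MvPolynomial σ K}
    {P : MvPolynomial σ K} (h : ∀ i ∈ P.vars, φ₁ (X i) = φ₂ (X i)) : φ₁ P = φ₂ P := by
  have := hom_congr_vars (f₁ := (φ₁ : MvPolynomial σ K →+* MvPolynomial σ K))
    (f₂ := (φ₂ : MvPolynomial σ K →+* MvPolynomial σ K)) (p₁ := P) (p₂ := P)
    (by ext r; simp [algHom_C]) (fun i hi _ => h i hi) rfl
  simpa using this

/-- `ψ♭` fixes a polynomial in the block variables only (derived here).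
[cite: AbramovichTemkinWlodarczyk2024, §3.4 (p. 1570)] -/
theorem blockFlat_eq_self_of_block {B : Finset σ} (ψ : MvPolynomial σ K →ₐ[K] MvPolynomial σ K)
    {P : MvPolynomial σ K} (hP : ∀ d ∈ P.support, ∀ i ∈ d.support, i ∈ B) :
    blockFlat B ψ P = P := by
  have h : ∀ i ∈ P.vars, blockFlat B ψ (X i) = (AlgHom.id K (MvPolynomial σ K)) (X i) := by
    intro i hi
    obtain ⟨d, hd, hid⟩ := (mem_vars_iff_mem_support i).mp hi
    rw [blockFlat_X_of_mem (hP d hd i hid), AlgHom.id_apply]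
  rw [algHom_congr_vars h, AlgHom.id_apply]

/-- `ψ♭` acts as `ψ` on a polynomial free of block variables (derived here).
[cite: AbramovichTemkinWlodarczyk2024, §3.4 (p. 1570)] -/
theorem blockFlat_eq_map_of_blockFree {B : Finset σ}
    (ψ : MvPolynomial σ K →ₐ[K] MvPolynomial σ K)
    {P : MvPolynomial σ K} (hP : ∀ d ∈ P.support, ∀ i ∈ d.support, i ∉ B) :
    blockFlat B ψ P = ψ P := by
  refine algHom_congr_vars fun i hi => ?_
  obtain ⟨d, hd, hid⟩ := (mem_vars_iff_mem_support i).mp hi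
  rw [blockFlat_X_of_not_mem (hP d hd i hid)]

/-- **(⋆) in the block monomial basis.**  If the top block layer `F = [H]ₘ₊₁` is a form in the
block variables and the next layer is expanded as `[H]ₘ = Σ_{β ∈ R} n_β · X^β` with block
exponents `β` and block-free `n_β`, then the layer equation (⋆) reads
`Σ_{k ∈ B} S_k ∂ₖ F = Σ_{β ∈ R} (n_β - ψ n_β) · X^β` (derived here).
[cite: HauserWagner2014, (T) translational move (arXiv p. 14–15)] -/
theorem IsBlockSubstitution.block_basis_identity {B : Finset σ}
    {ψ : MvPolynomial σ K →ₐ[K] MvPolynomial σ K} {S : σ → MvPolynomial σ K}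
    (hψ : IsBlockSubstitution B ψ S)
    {H : MvPolynomial σ K} {m : ℕ} (hH : ∀ d ∈ H.support, weight (blockWeight B) d ≤ m + 1)
    (hm : m ≠ 0) {c : K} (hQ : ψ H = H - C c)
    (hF : ∀ d ∈ (weightedHomogeneousComponent (blockWeight B) (m + 1) H).support,
      ∀ i ∈ d.support, i ∈ B)
    (R : Finset (σ →₀ ℕ)) (hR : ∀ β ∈ R, ∀ i ∈ β.support, i ∈ B)
    (n : (σ →₀ ℕ) → MvPolynomial σ K)
    (hn : ∀ β ∈ R, ∀ d ∈ (n β).support, ∀ i ∈ d.support, i ∉ B)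
    (hN : weightedHomogeneousComponent (blockWeight B) m H = ∑ β ∈ R, n β * monomial β 1) :
    ∑ k ∈ B, S k * pderiv k (weightedHomogeneousComponent (blockWeight B) (m + 1) H)
      = ∑ β ∈ R, (n β - ψ (n β)) * monomial β 1 := by
  have h := hψ.layer_equation hH hm hQ
  -- left-hand side: `ψ♭` fixes the derivatives of the pure-block form `F`
  have hl : blockDifferential B ψ S (weightedHomogeneousComponent (blockWeight B) (m + 1) H)
      = ∑ k ∈ B, S k * pderiv k (weightedHomogeneousComponent (blockWeight B) (m + 1) H) := by
    unfold blockDifferential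
    refine Finset.sum_congr rfl fun k _ => ?_
    rw [blockFlat_eq_self_of_block ψ
      (support_pderiv_subset_of_support {i | i ∉ B} (fun d hd i hi h => h (hF d hd i hi)) k
        |> fun h' d hd i hi => by by_contra hc; exact h' d hd i hi hc)]
  -- right-hand side: `ψ♭` is `ψ` on the block-free coefficients and fixes the block monomials
  have hmonB : ∀ β ∈ R, ∀ d ∈ (monomial β (1 : K)).support, ∀ i ∈ d.support, i ∈ B := by
    intro β hβ d hd i hi
    have hd' : d = β := Finset.mem_singleton.mp (support_monomial_subset hd)
    subst hd'
    exact hR d hβ i hi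
  have hr : weightedHomogeneousComponent (blockWeight B) m H
      - blockFlat B ψ (weightedHomogeneousComponent (blockWeight B) m H)
      = ∑ β ∈ R, (n β - ψ (n β)) * monomial β 1 := by
    rw [hN, map_sum, ← Finset.sum_sub_distrib]
    refine Finset.sum_congr rfl fun β hβ => ?_
    rw [map_mul, blockFlat_eq_map_of_blockFree ψ (hn β hβ), blockFlat_eq_self_of_block ψ (hmonB β hβ),
      sub_mul]
  rw [← hl, h, hr]

/-- **The `V = 0` branch of the block step (straightening), from the face equation.**  With the
data of `block_basis_identity`, shifts free of block variables, `ψ (n_β)` block-free, and `M(0)`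
injective on constant vectors, there are block-free `g_k` with `S_k = ψ(g_k) - g_k` and
`ψ (X_k - g_k) = X_k - g_k` for every `k ∈ B`: in the straightened coordinates the block does not
move (derived here; `WeightedCentreBlockShift.exists_straightening`).
[cite: HauserWagner2014, (T) translational move (arXiv p. 14–15)]
[cite: AbramovichTemkinWlodarczyk2024, §5.2 (pp. 1576–1577)] -/
theorem IsBlockSubstitution.exists_straightening_of_face_equation {B : Finset σ}
    {ψ : MvPolynomial σ K →ₐ[K] MvPolynomial σ K} {S : σ → MvPolynomial σ K}
    (hψ : IsBlockSubstitution B ψ S)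
    {H : MvPolynomial σ K} {m : ℕ} (hH : ∀ d ∈ H.support, weight (blockWeight B) d ≤ m + 1)
    (hm : m ≠ 0) {c : K} (hQ : ψ H = H - C c)
    (hF : ∀ d ∈ (weightedHomogeneousComponent (blockWeight B) (m + 1) H).support,
      ∀ i ∈ d.support, i ∈ B)
    (R : Finset (σ →₀ ℕ)) (hR : ∀ β ∈ R, ∀ i ∈ β.support, i ∈ B)
    (n : (σ →₀ ℕ) → MvPolynomial σ K)
    (hn : ∀ β ∈ R, ∀ d ∈ (n β).support, ∀ i ∈ d.support, i ∉ B)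
    (hψn : ∀ β ∈ R, ∀ d ∈ (ψ (n β)).support, ∀ i ∈ d.support, i ∉ B)
    (hN : weightedHomogeneousComponent (blockWeight B) m H = ∑ β ∈ R, n β * monomial β 1)
    (hS : ∀ k ∈ B, ∀ d ∈ (S k).support, ∀ i ∈ d.support, i ∉ B)
    (hinj : ∀ v : σ → K,
      (∑ k ∈ B, v k • pderiv k (weightedHomogeneousComponent (blockWeight B) (m + 1) H)) = 0 →
        ∀ k ∈ B, v k = 0) :
    ∃ g : σ → MvPolynomial σ K,
      (∀ k ∈ B, ∀ d ∈ (g k).support, ∀ i ∈ d.support, i ∉ B) ∧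
      (∀ k ∈ B, S k = ψ (g k) - g k) ∧
      (∀ k ∈ B, ψ (X k - g k) = X k - g k) :=
  exists_straightening B hF hinj R hR n hn ψ hψn hS hψ.map_X_of_mem
    (hψ.block_basis_identity hH hm hQ hF R hR n hn hN)

/-! ## Removing the data: block-free polynomials and the block-monomial expansion -/

omit [DecidableEq σ] in
/-- A polynomial free of block variables is block-homogeneous of degree `0` (derived here).
[cite: AbramovichTemkinWlodarczyk2024, §3.4 (p. 1570)] -/
theorem isWeightedHomogeneous_zero_of_blockFree [DecidableEq σ] {B : Finset σ}
    {P : MvPolynomial σ K} (hP : ∀ d ∈ P.support, ∀ i ∈ d.support, i ∉ B) :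
    IsWeightedHomogeneous (blockWeight B) P 0 := by
  intro d hd
  rw [weight_apply, Finsupp.sum]
  refine Finset.sum_eq_zero fun i hi => ?_
  rw [blockWeight_of_not_mem (hP d (MvPolynomial.mem_support_iff.mpr hd) i hi), smul_zero]

omit [DecidableEq σ] in
/-- A block-homogeneous polynomial of degree `0` is free of block variables (derived here).
[cite: AbramovichTemkinWlodarczyk2024, §3.4 (p. 1570)] -/
theorem blockFree_of_isWeightedHomogeneous_zero [DecidableEq σ] {B : Finset σ}
    {P : MvPolynomial σ K} (hP : IsWeightedHomogeneous (blockWeight B) P 0) :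
    ∀ d ∈ P.support, ∀ i ∈ d.support, i ∉ B := by
  intro d hd i hi hiB
  have h := hP (MvPolynomial.mem_support_iff.mp hd)
  rw [weight_apply, Finsupp.sum] at h
  have h1 := Finset.sum_eq_zero_iff.mp h i hi
  rw [blockWeight_of_mem hiB, smul_eq_mul, mul_one] at h1
  exact (Finsupp.mem_support_iff.mp hi) h1

/-- A block substitution maps block-free polynomials to block-free polynomials (derived here: on
them `ψ = ψ♭`, which is graded). [cite: AbramovichTemkinWlodarczyk2024, §3.4 (p. 1570)] -/
theorem IsBlockSubstitution.map_blockFree {B : Finset σ}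
    {ψ : MvPolynomial σ K →ₐ[K] MvPolynomial σ K} {S : σ → MvPolynomial σ K}
    (hψ : IsBlockSubstitution B ψ S) {P : MvPolynomial σ K}
    (hP : ∀ d ∈ P.support, ∀ i ∈ d.support, i ∉ B) :
    ∀ d ∈ (ψ P).support, ∀ i ∈ d.support, i ∉ B := by
  rw [← blockFlat_eq_map_of_blockFree ψ hP]
  exact blockFree_of_isWeightedHomogeneous_zero
    (isWeightedHomogeneous_blockFlat hψ.map_X_free (isWeightedHomogeneous_zero_of_blockFree hP))

/-- **Block-monomial expansion.**  Every polynomial `N` is `Σ_{β ∈ R} n_β · X^β` with block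
exponents `β` (the block parts of the monomials of `N`) and block-free coefficients `n_β`
(derived here: split each exponent into its block part and its off-block part).
[cite: AbramovichTemkinWlodarczyk2024, §3.4 (p. 1570)] -/
theorem exists_block_expansion (B : Finset σ) (N : MvPolynomial σ K) :
    ∃ R : Finset (σ →₀ ℕ), ∃ n : (σ →₀ ℕ) → MvPolynomial σ K,
      (∀ β ∈ R, ∀ i ∈ β.support, i ∈ B) ∧
      (∀ β ∈ R, ∀ d ∈ (n β).support, ∀ i ∈ d.support, i ∉ B) ∧
      N = ∑ β ∈ R, n β * monomial β 1 := by
  classical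
  let bl : (σ →₀ ℕ) → (σ →₀ ℕ) := fun d => d.filter (· ∈ B)
  let off : (σ →₀ ℕ) → (σ →₀ ℕ) := fun d => d.filter (¬ (· ∈ B) ·)
  refine ⟨N.support.image bl,
    fun β => ∑ d ∈ N.support with bl d = β, monomial (off d) (coeff d N), ?_, ?_, ?_⟩
  · intro β hβ i hi
    obtain ⟨d, _, rfl⟩ := Finset.mem_image.mp hβ
    have h := Finsupp.mem_support_iff.mp hi
    by_contra hiB
    exact h (Finsupp.filter_apply_neg (· ∈ B) d hiB)
  · intro β _ d hd i hi hiB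
    obtain ⟨d', _, hdd'⟩ := Finset.mem_biUnion.mp (support_sum hd)
    have hdo : d = off d' := Finset.mem_singleton.mp (support_monomial_subset hdd')
    subst hdo
    have h := Finsupp.mem_support_iff.mp hi
    exact h (Finsupp.filter_apply_neg (¬ (· ∈ B) ·) d' (not_not.mpr hiB))
  · symm
    calc ∑ β ∈ N.support.image bl, (∑ d ∈ N.support with bl d = β, monomial (off d) (coeff d N))
            * monomial β 1
        = ∑ β ∈ N.support.image bl, ∑ d ∈ N.support with bl d = β, monomial d (coeff d N) := by
          refine Finset.sum_congr rfl fun β _ => ?_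
          rw [Finset.sum_mul]
          refine Finset.sum_congr rfl fun d hd => ?_
          have hb : bl d = β := (Finset.mem_filter.mp hd).2
          rw [← hb, monomial_mul, mul_one, add_comm]
          show monomial (d.filter (· ∈ B) + d.filter (¬ (· ∈ B) ·)) (coeff d N) = _
          rw [Finsupp.filter_add_filter_not]
      _ = ∑ d ∈ N.support, monomial d (coeff d N) :=
          Finset.sum_fiberwise_of_maps_to (fun d hd => Finset.mem_image_of_mem bl hd) _
      _ = N := N.as_sum.symm

/-- **The `V = 0` branch, hypothesis-light.**  For a block substitution satisfying the face
equation (`H` of block degree `≤ m + 1`, `m ≠ 0`) whose top block layer is a form in the block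
variables, injectivity of `v ↦ Σ_k v_k ∂ₖ [H]ₘ₊₁` on constant vectors (`M(0)` injective, `V = 0`)
yields block-free `g_k` with `S_k = ψ(g_k) - g_k` and `ψ (X_k - g_k) = X_k - g_k` on the block:
the straightened block does not move (derived here: expansion + `block_basis_identity` +
`WeightedCentreBlockShift.exists_straightening`).
[cite: HauserWagner2014, (T) translational move (arXiv p. 14–15)]
[cite: AbramovichTemkinWlodarczyk2024, §5.2 (pp. 1576–1577)] -/
theorem IsBlockSubstitution.exists_straightening_of_injective {B : Finset σ}
    {ψ : MvPolynomial σ K →ₐ[K] MvPolynomial σ K} {S : σ → MvPolynomial σ K}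
    (hψ : IsBlockSubstitution B ψ S)
    {H : MvPolynomial σ K} {m : ℕ} (hH : ∀ d ∈ H.support, weight (blockWeight B) d ≤ m + 1)
    (hm : m ≠ 0) {c : K} (hQ : ψ H = H - C c)
    (hF : ∀ d ∈ (weightedHomogeneousComponent (blockWeight B) (m + 1) H).support,
      ∀ i ∈ d.support, i ∈ B)
    (hinj : ∀ v : σ → K,
      (∑ k ∈ B, v k • pderiv k (weightedHomogeneousComponent (blockWeight B) (m + 1) H)) = 0 →
        ∀ k ∈ B, v k = 0) :
    ∃ g : σ → MvPolynomial σ K,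
      (∀ k ∈ B, ∀ d ∈ (g k).support, ∀ i ∈ d.support, i ∉ B) ∧
      (∀ k ∈ B, S k = ψ (g k) - g k) ∧
      (∀ k ∈ B, ψ (X k - g k) = X k - g k) := by
  obtain ⟨R, n, hR, hn, hN⟩ :=
    exists_block_expansion B (weightedHomogeneousComponent (blockWeight B) m H)
  have hS : ∀ k ∈ B, ∀ d ∈ (S k).support, ∀ i ∈ d.support, i ∉ B :=
    fun k hk => blockFree_of_isWeightedHomogeneous_zero (hψ.shift_free k hk)
  have hψn : ∀ β ∈ R, ∀ d ∈ (ψ (n β)).support, ∀ i ∈ d.support, i ∉ B :=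
    fun β hβ => hψ.map_blockFree (hn β hβ)
  exact hψ.exists_straightening_of_face_equation hH hm hQ hF R hR n hn hψn hN hS hinj

end Literature.AlgebraicGeometry.Resolution.WeightedBlowup
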